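import Summits.QuantumFields.YangMills.Theorems.BalabanUVNodesN22KnitWitness
import Summits.QuantumFields.YangMills.Theorems.BalabanUVNodesN22KnitDiscrete
import Literature.MathematicalPhysics.QuantumFieldTheory.Balaban1983to89.B9Eq319BumpProfileCos

/-!
# BalabanUVNodes ∕ node N22 = NE9 — ROAD 2 IS RATE-SHARP: a chirp tower on the abstract output carriers at which dag-n22-a's
# discrete Landau–Kolmogorov road (`…N22KnitDiscrete`: (P) + oscillation fading at the tower rate `θ` + second differences with
# constants NOT growing in the age ⟹ `NE9 ∧ FadingMemory` at the rate `√θ`) FIRES, and at which NO moduli family with `NE9` fades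
# faster than `√θ` (Track A, DAG node N22 = NE9; cluster K4 «SpineRates»; WIDTH SEAT `pub-ymgap-dag-n22-w1`, harness re-seat g4)

Cell `pub-ymgap`, HUMAN RULING D-0062 (Track A) ∕ D-0149; `--kind proof --supports stmt-QuantumFields-20544 --as helper` (K3⁷
`SpineGivenEndpointR13SepCoPH`), COUNT-NEUTRAL.  THEOREMS ONLY (0 `def`, 0 `sorry`, standard axioms).  Imports dag-n22-a's
`…N22KnitWitness` (through it `T4OutputRate`, the toy carriers and `BornLambdaLetters.sum_pow_sub_le`), `…N22KnitDiscrete` (ROAD 2)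
and lit `B9Eq319BumpProfileCos` (`abs_cos_second_diff_le`) BY NAME.  Companion file `…N22KnitRoadRatesSharpTwoConstants` does the same for ROAD 3.

WHY.  Node N22's statement of record is `T4OutputRate.NE9 E (Window γ) κ Λ ∧ FadingMemory C₉ ω Λ`, and K3⁷ v5 pins the moduli to a letter
block's geometric table `ℓ.C₉·ℓ.ω^{k−i}` next to node N18's tower rate `ℓ.θ₅` (`Node00/RateRecord11.U3Letters₁₁`).  Three kernel roads produce
the pair from node N18's rate: ROAD 1 (Cauchy tables from age-growing coupling radii — this seat's g2∕g3 files, rate-certified by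
`…N22W1CouplingRadiiPhaseTowerSharp`), ROAD 2 (`N22KnitDiscrete.ne9_and_fadingMemory_of_osc_secondDiff`: oscillation fading (O) at rate `θ` +
second differences (R₂) `≤ M·μ^{age−1}e^{−κd}d²` ⟹ fading at every `τ` with `θ ≤ τρ`, `μρ ≤ τ` — i.e. `τ ≥ √(θμ)`; with UNIFORM `M` (`μ = 1`)
the rate `√θ`) and ROAD 3 (`N22KnitTwoConstants`: (O) + uniform-margin analyticity ⟹ every rate above `θ`).  ROAD 2 is the one dag-n22-c's
J38 carries to the kernel record (pub-ymgap INBOX l.34951), booking the letter row `ℓ.θ₅ ≤ ℓ.ω²`.  THIS FILE certifies that row: the square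
root is NOT an artefact of the real-variable interpolation but the TRUE exponent on ROAD 2's hypotheses.  The witness is the CHIRP TOWER
`E g U X = e^{−κd(X)}·Σ_{i<k} θ^{k−i}·cos((π∕2γ)(√θ)^{−(k−i)}·g_i)` (`k = scale X`): amplitude `θ^{age}` (so (O) holds at rate `θ`), frequency
`(√θ)^{−age}` (so the second differences are UNIFORMLY bounded, `θ^{a}·((√θ)^{−a})² = 1`), hence coupling sensitivity EXACTLY
`(π∕2γ)(√θ)^{age}` at the interior point `g_i = γ(√θ)^{age}` of the window.

WHAT (all [folklore]).
* §1 PROFILE TOWERS `e^{−κd}Σ θ^{age}φ_{age}(g_i)` on ANY carriers: `prefixDependenceOn_profileTower` (P), `profileTower_update_sub_update`,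
  `osc_profileTower` ((O): `|φ| ≤ 1`, `0 ≤ θ < 1` ⟹ `C₀ = 2θ∕(1−θ)` at rate `θ`), `abs_profileTower_le` (the printed decay-bound shape
  `θ∕(1−θ)·e^{−κd}`), ★ `pow_mul_abs_deriv_le_moduli_of_ne9` — MODULI EXTRACTION: any `Λ` with `NE9 E (Window γ) κ Λ` dominates
  `θ^{k−i}·|φ′_{k−i}(s)|` at every interior `s ∈ ]0, γ[` (`HasDerivAt.le_of_lip'`).
* §2 ROAD 2 at the chirp tower: `secondDiff_chirpTower` ((R₂) with the UNIFORM constant `M = (π∕2γ)²`, `μ = 1`; the cosine's second difference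
  is lit `B9Eq319BumpProfileCos.abs_cos_second_diff_le` BY NAME), ★ `road2_chirpTower` (ROAD 2
  FIRES: `∃ C₉, NE9 E (Window γ) κ (C₉(√θ)^{k−i}) ∧ FadingMemory C₉ √θ _`, at `ρ = τ = √θ`), ★★ `sqrt_pow_le_moduli_chirpTower` (EVERY `Λ`
  with `NE9 E (Window γ) κ Λ` has `(π∕2γ)(√θ)^{k−i} ≤ Λ k i`, `i < k = scale X`), ★★ `sqrt_le_rate_of_fadingMemory_chirpTower` (carriers with
  a domain at every scale: `NE9 … Λ ∧ FadingMemory C₉ τ Λ ∧ 0 ≤ τ ⟹ √θ ≤ τ`).  The ∃-packaging on `natCarriers` is in the companion file.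
READING.  On ROAD 2's hypotheses — (P), (O) at rate `θ`, (R₂) with age-uniform constants, nothing else — the best fading rate is `√θ`,
attained by the road and unbeatable at this model; a sharper rate needs MORE than second differences (ROAD 3's analyticity gives every
`τ > θ`, and the companion file shows `τ = θ` is out of reach even there).  For K3⁷'s letter block: a producer feeding `h9` through ROAD 2
must book `θ₅ ≤ ω²`; through ROAD 3, `θ₅ < ω`.

HONEST FRAMING.  MODEL towers on abstract ∕ toy carriers (configuration-blind cosines weighted by `e^{−κd}`) — NOT NODE 00's objects;
nothing of Bałaban's construction is asserted or met; count-neutral A5∕R3-class helper (what the roads' letter rows can and cannot be);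
N22 NOT discharged (typed 28∕28 · discharged 5∕27 UNMOVED — the chair's single count line is the only count); K3⁷ OPEN, NOT claimed,
skeleton v5 untouched; NE5 ∕ NE9 NOT IN PRINT for d = 4; one finite four-torus programme at fixed ε — R4 closes the CONDITIONAL rung
`BalabanLadder.UV` only; NOT infinite volume, NOT OS on ℝ⁴, NOT a mass gap, NOT Clay.

References (TYPES only): [Balaban1987RG1] = T. Bałaban, Commun. Math. Phys. **109** (1987) 249–301 — p. 256 (prefix dependence), Thm 1
p. 259, (1.18) and the «C^∞ (or analytic)» clause p. 263, §5 p. 298; the Landau–Kolmogorov interpolation as typed in `…N22KnitDiscrete` §1.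
-/

noncomputable section

namespace YMDAG.N22.RoadRates

open Set Real Filter Metric
open scoped BigOperators Topology
open Literature.MathematicalPhysics.QuantumFieldTheory.Balaban1983to89
open Literature.MathematicalPhysics.QuantumFieldTheory.Balaban1983to89.T4OutputRate
open Literature.MathematicalPhysics.QuantumFieldTheory.Balaban1983to89.T4CouplingAnalyticity (update_mem_boxWindow)
open Literature.MathematicalPhysics.QuantumFieldTheory.Balaban1983to89.T4CouplingAnalyticityWitness (natCarriers)
open Summit.QuantumFields.BalabanUV.Beta.GAN24.BornLambdaLetters (sum_pow_sub_le)
open Literature.MathematicalPhysics.QuantumFieldTheory.Balaban1983to89.B9Eq319BumpProfileCos (abs_cos_second_diff_le)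
open Summit.QuantumFields.YangMills.BalabanUVNodes.N22KnitDiscrete (ne9_and_fadingMemory_of_osc_secondDiff)

/-! ## §1 PROFILE TOWERS `E g U X = e^{−κd(X)}·Σ_{i<scale X} θ^{scale X − i}·φ_{scale X − i}(g_i)` on any carriers: (P), (O) at the
tower rate `θ`, the one-coupling update formula, and the EXTRACTION of a lower bound on any `NE9` moduli family from a derivative of
the profile at an interior point of the window -/

section Profile

variable {C : Carriers} {Bg : Type} {E : Functional C Bg} {θ κ : ℝ} {φ : ℕ → ℝ → ℝ}

/-- (P) PREFIX DEPENDENCE of a profile tower: the scale-`k` term reads `g₀, …, g_{k−1}` only. [folklore] -/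
theorem prefixDependenceOn_profileTower (W : Set (ℕ → ℝ))
    (hE : ∀ g U X, E g U X = Real.exp (-(κ * C.d X)) *
      ∑ i ∈ Finset.range (C.scale X), θ ^ (C.scale X - i) * φ (C.scale X - i) (g i)) :
    PrefixDependenceOn E W := by
  intro g _ g' _ U X hagree
  rw [hE, hE]
  congr 1
  exact Finset.sum_congr rfl fun i hi => by rw [hagree i (Finset.mem_range.mp hi)]

/-- THE ONE-COUPLING UPDATE FORMULA: changing the `i`-th coupling (`i < scale X`) from `s` to `t` moves the term by
`e^{−κd(X)}·θ^{scale X − i}·(φ(t) − φ(s))`. [folklore] -/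
theorem profileTower_update_sub_update
    (hE : ∀ g U X, E g U X = Real.exp (-(κ * C.d X)) *
      ∑ i ∈ Finset.range (C.scale X), θ ^ (C.scale X - i) * φ (C.scale X - i) (g i))
    (g : ℕ → ℝ) (U : Bg) (X : C.Dom) {i : ℕ} (hi : i < C.scale X) (t s : ℝ) :
    E (Function.update g i t) U X - E (Function.update g i s) U X =
      Real.exp (-(κ * C.d X)) * θ ^ (C.scale X - i) * (φ (C.scale X - i) t - φ (C.scale X - i) s) := by
  rw [hE, hE, ← mul_sub, ← Finset.sum_sub_distrib, mul_assoc]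
  congr 1
  rw [Finset.sum_eq_single i]
  · rw [Function.update_self, Function.update_self, mul_sub]
  · intro m _ hm
    rw [Function.update_of_ne hm, Function.update_of_ne hm, sub_self]
  · intro hi'
    exact absurd (Finset.mem_range.mpr hi) hi'

/-- (O) OSCILLATION FADING AT THE TOWER RATE (the tower-NE5 shape the roads consume): if `|φ_a| ≤ 1` and `0 ≤ θ < 1`, two admissible
histories agreeing at every index `≥ a` (`a ≤ scale X`) give terms within `(2θ∕(1−θ))·θ^{scale X − a}·e^{−κd(X)}` — the old block
`i < a` is a geometric tail (`BornLambdaLetters.sum_pow_sub_le` BY NAME). [folklore] -/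
theorem osc_profileTower {γ : ℝ}
    (hE : ∀ g U X, E g U X = Real.exp (-(κ * C.d X)) *
      ∑ i ∈ Finset.range (C.scale X), θ ^ (C.scale X - i) * φ (C.scale X - i) (g i))
    (hφ : ∀ a t, |φ a t| ≤ 1) (hθ0 : 0 ≤ θ) (hθ1 : θ < 1) :
    ∀ g ∈ Window γ, ∀ g' ∈ Window γ, ∀ (U : Bg) (X : C.Dom) (a : ℕ), a ≤ C.scale X →
      (∀ n, a ≤ n → g n = g' n) →
      |E g U X - E g' U X| ≤ 2 * θ / (1 - θ) * θ ^ (C.scale X - a) * Real.exp (-(κ * C.d X)) := by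
  intro g _ g' _ U X a _ hagree
  set j := C.scale X with hj
  set w := Real.exp (-(κ * C.d X)) with hw
  have hw0 : 0 < w := Real.exp_pos _
  have hsub : E g U X - E g' U X = w * ∑ i ∈ Finset.range j, θ ^ (j - i) * (φ (j - i) (g i) - φ (j - i) (g' i)) := by
    rw [hE, hE, ← hj, ← hw, ← mul_sub, ← Finset.sum_sub_distrib]
    congr 1
    exact Finset.sum_congr rfl fun i _ => by ring
  have hterm : ∀ i ∈ Finset.range j, |θ ^ (j - i) * (φ (j - i) (g i) - φ (j - i) (g' i))| ≤
      if i < a then 2 * (θ ^ (j - a) * θ ^ (a - i)) else 0 := by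
    intro i hi
    rw [Finset.mem_range] at hi
    by_cases hia : i < a
    · rw [if_pos hia, abs_mul, abs_of_nonneg (pow_nonneg hθ0 _), ← pow_add, show j - a + (a - i) = j - i by omega]
      have h2 : |φ (j - i) (g i) - φ (j - i) (g' i)| ≤ 2 := by
        calc |φ (j - i) (g i) - φ (j - i) (g' i)| ≤ |φ (j - i) (g i)| + |φ (j - i) (g' i)| := abs_sub _ _
          _ ≤ 1 + 1 := add_le_add (hφ _ _) (hφ _ _)
          _ = 2 := by norm_num
      calc θ ^ (j - i) * |φ (j - i) (g i) - φ (j - i) (g' i)| ≤ θ ^ (j - i) * 2 :=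
            mul_le_mul_of_nonneg_left h2 (pow_nonneg hθ0 _)
        _ = 2 * θ ^ (j - i) := mul_comm _ _
    · rw [if_neg hia, hagree i (not_lt.mp hia), sub_self, mul_zero, abs_zero]
  have hsum : |∑ i ∈ Finset.range j, θ ^ (j - i) * (φ (j - i) (g i) - φ (j - i) (g' i))| ≤ 2 * θ ^ (j - a) * (θ / (1 - θ)) := by
    calc |∑ i ∈ Finset.range j, θ ^ (j - i) * (φ (j - i) (g i) - φ (j - i) (g' i))|
        ≤ ∑ i ∈ Finset.range j, |θ ^ (j - i) * (φ (j - i) (g i) - φ (j - i) (g' i))| := Finset.abs_sum_le_sum_abs _ _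
      _ ≤ ∑ i ∈ Finset.range j, (if i < a then 2 * (θ ^ (j - a) * θ ^ (a - i)) else 0) := Finset.sum_le_sum hterm
      _ = ∑ i ∈ Finset.range a, 2 * (θ ^ (j - a) * θ ^ (a - i)) := by
          rw [Finset.sum_ite, Finset.sum_const_zero, add_zero]
          congr 1
          ext i
          simp only [Finset.mem_filter, Finset.mem_range]
          omega
      _ = 2 * θ ^ (j - a) * ∑ i ∈ Finset.range a, θ ^ (a - i) := by
          rw [Finset.mul_sum]
          exact Finset.sum_congr rfl fun i _ => by ring
      _ ≤ 2 * θ ^ (j - a) * (θ / (1 - θ)) :=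
          mul_le_mul_of_nonneg_left (sum_pow_sub_le hθ0 hθ1 a) (mul_nonneg (by norm_num) (pow_nonneg hθ0 _))
  rw [hsub, abs_mul, abs_of_pos hw0]
  calc w * |∑ i ∈ Finset.range j, θ ^ (j - i) * (φ (j - i) (g i) - φ (j - i) (g' i))| ≤ w * (2 * θ ^ (j - a) * (θ / (1 - θ))) :=
        mul_le_mul_of_nonneg_left hsum hw0.le
    _ = 2 * θ / (1 - θ) * θ ^ (j - a) * w := by ring

/-- UNIFORM SIZE of a profile tower: `|E g U X| ≤ (θ∕(1−θ))·e^{−κd(X)}` when `|φ_a| ≤ 1`, `0 ≤ θ < 1` (the printed decay-bound shape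
`DecayBound E W (θ∕(1−θ)) κ` on any window). [folklore] -/
theorem abs_profileTower_le
    (hE : ∀ g U X, E g U X = Real.exp (-(κ * C.d X)) *
      ∑ i ∈ Finset.range (C.scale X), θ ^ (C.scale X - i) * φ (C.scale X - i) (g i))
    (hφ : ∀ a t, |φ a t| ≤ 1) (hθ0 : 0 ≤ θ) (hθ1 : θ < 1) (g : ℕ → ℝ) (U : Bg) (X : C.Dom) :
    |E g U X| ≤ θ / (1 - θ) * Real.exp (-(κ * C.d X)) := by
  rw [hE, abs_mul, abs_of_pos (Real.exp_pos _), mul_comm]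
  refine mul_le_mul_of_nonneg_right ?_ (Real.exp_pos _).le
  calc |∑ i ∈ Finset.range (C.scale X), θ ^ (C.scale X - i) * φ (C.scale X - i) (g i)|
      ≤ ∑ i ∈ Finset.range (C.scale X), |θ ^ (C.scale X - i) * φ (C.scale X - i) (g i)| := Finset.abs_sum_le_sum_abs _ _
    _ ≤ ∑ i ∈ Finset.range (C.scale X), θ ^ (C.scale X - i) := Finset.sum_le_sum fun i _ => by
        rw [abs_mul, abs_of_nonneg (pow_nonneg hθ0 _)]
        exact mul_le_of_le_one_right (pow_nonneg hθ0 _) (hφ _ _)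
    _ ≤ θ / (1 - θ) := sum_pow_sub_le hθ0 hθ1 _

/-- **MODULI EXTRACTION.**  If a profile tower satisfies node N22's `NE9 E (Window γ) κ Λ` for SOME moduli family `Λ` (`γ > 0`,
`θ ≥ 0`), then at every interior point `s ∈ ]0, γ[` where the age-`(k − i)` profile has a derivative `D`, the modulus in the coupling `i`
at level `k = scale X` dominates `θ^{k−i}·|D|`: vary the `i`-th coupling of the constant history `γ` inside the window, read `NE9`
as a Lipschitz bound of the section `t ↦ θ^{k−i}φ(t)` near `s`, and apply the converse mean-value inequality
(`HasDerivAt.le_of_lip'`). [folklore] -/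
theorem pow_mul_abs_deriv_le_moduli_of_ne9 {γ : ℝ}
    (hE : ∀ g U X, E g U X = Real.exp (-(κ * C.d X)) *
      ∑ i ∈ Finset.range (C.scale X), θ ^ (C.scale X - i) * φ (C.scale X - i) (g i))
    (hγ : 0 < γ) (hθ0 : 0 ≤ θ) {Λ : ℕ → ℕ → ℝ} (hN : NE9 E (Window γ) κ Λ) (U : Bg) (X : C.Dom) {i : ℕ}
    (hi : i < C.scale X) {s D : ℝ} (hs : s ∈ Ioo (0 : ℝ) γ) (hD : HasDerivAt (φ (C.scale X - i)) D s) :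
    θ ^ (C.scale X - i) * |D| ≤ Λ (C.scale X) i := by
  set k := C.scale X with hk
  set w := Real.exp (-(κ * C.d X)) with hw
  have hw0 : 0 < w := Real.exp_pos _
  -- the constant history `γ` and its one-coupling updates stay in the window
  set g₀ : ℕ → ℝ := fun _ => γ with hg₀
  have hg₀W : g₀ ∈ Window γ := fun _ => ⟨hγ, le_rfl⟩
  have hupdW : ∀ t ∈ Ioc (0 : ℝ) γ, Function.update g₀ i t ∈ Window γ := fun t ht => update_mem_boxWindow hg₀W i ht
  -- `NE9` between two updates reads ONE modulus
  have hLip : ∀ t ∈ Ioc (0 : ℝ) γ, ∀ t' ∈ Ioc (0 : ℝ) γ,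
      θ ^ (k - i) * |φ (k - i) t - φ (k - i) t'| ≤ Λ k i * |t - t'| := by
    intro t ht t' ht'
    have h := hN _ (hupdW t ht) _ (hupdW t' ht') U X
    rw [profileTower_update_sub_update hE g₀ U X hi t t', ← hk, ← hw] at h
    have hsum : ∑ m ∈ Finset.range k, Λ k m * |Function.update g₀ i t m - Function.update g₀ i t' m| = Λ k i * |t - t'| := by
      rw [Finset.sum_eq_single i]
      · rw [Function.update_self, Function.update_self]
      · intro m _ hm
        rw [Function.update_of_ne hm, Function.update_of_ne hm, sub_self, abs_zero, mul_zero]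
      · intro hi'
        exact absurd (Finset.mem_range.mpr hi) hi'
    rw [hsum, abs_mul, abs_mul, abs_of_pos hw0, abs_of_nonneg (pow_nonneg hθ0 _), mul_assoc] at h
    exact le_of_mul_le_mul_left h hw0
  -- the modulus is nonnegative (test two distinct points of the window)
  have hΛ0 : 0 ≤ Λ k i := by
    have hs2 : s / 2 ∈ Ioc (0 : ℝ) γ := ⟨by linarith [hs.1], by linarith [hs.2]⟩
    have hs1 : s ∈ Ioc (0 : ℝ) γ := ⟨hs.1, hs.2.le⟩
    have h := (mul_nonneg (pow_nonneg hθ0 _) (abs_nonneg _)).trans (hLip s hs1 (s / 2) hs2)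
    have hpos : 0 < |s - s / 2| := by rw [abs_of_pos (by linarith [hs.1])]; linarith [hs.1]
    exact nonneg_of_mul_nonneg_left h hpos
  -- converse mean value inequality at `s` for the section `t ↦ θ^{k−i} φ t`
  have hder : HasDerivAt (fun t => θ ^ (k - i) * φ (k - i) t) (θ ^ (k - i) * D) s := hD.const_mul _
  have hev : ∀ᶠ t in 𝓝 s, ‖θ ^ (k - i) * φ (k - i) t - θ ^ (k - i) * φ (k - i) s‖ ≤ Λ k i * ‖t - s‖ := by
    filter_upwards [Ioo_mem_nhds hs.1 hs.2] with t ht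
    rw [Real.norm_eq_abs, Real.norm_eq_abs, ← mul_sub, abs_mul, abs_of_nonneg (pow_nonneg hθ0 _)]
    exact hLip t ⟨ht.1, ht.2.le⟩ s ⟨hs.1, hs.2.le⟩
  have h := hder.le_of_lip' hΛ0 hev
  rwa [Real.norm_eq_abs, abs_mul, abs_of_nonneg (pow_nonneg hθ0 _)] at h

end Profile

/-! ## §2 ROAD 2 IS RATE-SHARP: the chirp tower `φ_a(t) = cos((π∕2γ)·(√θ)^{−a}·t)` — uniform second differences, ROAD 2 fires at
`√θ`, and NO `NE9` moduli family fades faster than `√θ` -/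

section Road2

variable {C : Carriers} {Bg : Type} {E : Functional C Bg} {θ κ γ : ℝ}

/-- `(√θ)^a·(√θ)^a = θ^a`. [folklore] -/
theorem sqrt_pow_mul_self {θ : ℝ} (hθ : 0 ≤ θ) (a : ℕ) : Real.sqrt θ ^ a * Real.sqrt θ ^ a = θ ^ a := by
  rw [← mul_pow, Real.mul_self_sqrt hθ]

/-- **(R₂) WITH A UNIFORM CONSTANT** at the chirp tower: every young-coupling section has second differences
`≤ (π∕2γ)²·1^{age−1}·e^{−κd(X)}·d²` — the frequency `(√θ)^{−age}` squared EXACTLY cancels the amplitude `θ^{age}`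
(`B9Eq319BumpProfileCos.abs_cos_second_diff_le` BY NAME).  This is ROAD 2's hypothesis (R₂) with `M = (π∕2γ)²`, `μ = 1`. [folklore] -/
theorem secondDiff_chirpTower
    (hE : ∀ g U X, E g U X = Real.exp (-(κ * C.d X)) *
      ∑ i ∈ Finset.range (C.scale X), θ ^ (C.scale X - i) *
        Real.cos (π / (2 * γ) * (Real.sqrt θ ^ (C.scale X - i))⁻¹ * g i))
    (hθ0 : 0 < θ) :
    ∀ g ∈ Window γ, ∀ (U : Bg) (X : C.Dom) (i : ℕ), i < C.scale X → ∀ t d : ℝ, 0 < d →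
      t - d ∈ Ioc (0 : ℝ) γ → t + d ∈ Ioc (0 : ℝ) γ →
        |E (Function.update g i (t + d)) U X - 2 * E (Function.update g i t) U X + E (Function.update g i (t - d)) U X| ≤
          (π / (2 * γ)) ^ 2 * 1 ^ (C.scale X - 1 - i) * Real.exp (-(κ * C.d X)) * d ^ 2 := by
  intro g _ U X i hi t d _ _ _
  set k := C.scale X with hk
  set w := Real.exp (-(κ * C.d X)) with hw
  set ν : ℝ := π / (2 * γ) * (Real.sqrt θ ^ (k - i))⁻¹ with hν
  have h1 := profileTower_update_sub_update (φ := fun a t => Real.cos (π / (2 * γ) * (Real.sqrt θ ^ a)⁻¹ * t)) hE g U X hi (t + d) t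
  have h2 := profileTower_update_sub_update (φ := fun a t => Real.cos (π / (2 * γ) * (Real.sqrt θ ^ a)⁻¹ * t)) hE g U X hi (t - d) t
  simp only [← hk, ← hw, ← hν] at h1 h2
  have e : E (Function.update g i (t + d)) U X - 2 * E (Function.update g i t) U X + E (Function.update g i (t - d)) U X
      = w * θ ^ (k - i) * (Real.cos (ν * t + ν * d) - 2 * Real.cos (ν * t) + Real.cos (ν * t - ν * d)) := by
    rw [← mul_add ν, ← mul_sub ν]; linarith
  have hsq : Real.sqrt θ ^ (k - i) * Real.sqrt θ ^ (k - i) = θ ^ (k - i) := sqrt_pow_mul_self hθ0.le _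
  have hσ : 0 < Real.sqrt θ ^ (k - i) := pow_pos (Real.sqrt_pos.2 hθ0) _
  have hw0 : 0 < w := Real.exp_pos _
  have hνsq : θ ^ (k - i) * ν ^ 2 = (π / (2 * γ)) ^ 2 := by
    rw [hν, mul_pow, inv_pow, sq (Real.sqrt θ ^ (k - i)), hsq]
    field_simp
  rw [e, abs_mul, abs_mul, abs_of_pos hw0, abs_of_nonneg (pow_nonneg hθ0.le _), one_pow, mul_one]
  calc w * θ ^ (k - i) * |Real.cos (ν * t + ν * d) - 2 * Real.cos (ν * t) + Real.cos (ν * t - ν * d)|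
      ≤ w * θ ^ (k - i) * (ν * d) ^ 2 :=
        mul_le_mul_of_nonneg_left (abs_cos_second_diff_le _ _) (mul_nonneg hw0.le (pow_nonneg hθ0.le _))
    _ = (π / (2 * γ)) ^ 2 * w * d ^ 2 := by rw [mul_pow, ← hνsq]; ring

/-- **ROAD 2 FIRES AT THE CHIRP TOWER, AT THE RATE `√θ`.**  (P) + (O) (`C₀ = 2θ∕(1−θ)`, rate `θ`) + (R₂) (`M = (π∕2γ)²`, `μ = 1`) feed
dag-n22-a's `N22KnitDiscrete.ne9_and_fadingMemory_of_osc_secondDiff` BY NAME with the step ratio `ρ = √θ` and the rate `τ = √θ`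
(`θ ≤ τρ`, `μρ ≤ τ`): node N22's statement shape `NE9 E (Window γ) κ Λ₁ ∧ FadingMemory C₉ √θ Λ₁` HOLDS at the model. [folklore] -/
theorem road2_chirpTower
    (hE : ∀ g U X, E g U X = Real.exp (-(κ * C.d X)) *
      ∑ i ∈ Finset.range (C.scale X), θ ^ (C.scale X - i) *
        Real.cos (π / (2 * γ) * (Real.sqrt θ ^ (C.scale X - i))⁻¹ * g i))
    (hγ : 0 < γ) (hθ0 : 0 < θ) (hθ1 : θ < 1) :
    ∃ C₉ : ℝ, NE9 E (Window γ) κ (fun k i => C₉ * Real.sqrt θ ^ (k - i)) ∧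
      FadingMemory C₉ (Real.sqrt θ) (fun k i => C₉ * Real.sqrt θ ^ (k - i)) := by
  have hσ0 : 0 < Real.sqrt θ := Real.sqrt_pos.2 hθ0
  have hσ1 : Real.sqrt θ < 1 := by rw [← Real.sqrt_one]; exact Real.sqrt_lt_sqrt hθ0.le hθ1
  have hP := prefixDependenceOn_profileTower (Window γ)
    (φ := fun a t => Real.cos (π / (2 * γ) * (Real.sqrt θ ^ a)⁻¹ * t)) hE
  have hO := osc_profileTower (γ := γ) (φ := fun a t => Real.cos (π / (2 * γ) * (Real.sqrt θ ^ a)⁻¹ * t)) hE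
    (fun _ _ => Real.abs_cos_le_one _) hθ0.le hθ1
  have hR2 := secondDiff_chirpTower hE hθ0
  have h1θ : 0 < 1 - θ := by linarith
  have h := ne9_and_fadingMemory_of_osc_secondDiff (ρ := Real.sqrt θ) (τ := Real.sqrt θ) hP hO hR2
    (by positivity) hθ0.le (by positivity) zero_le_one hγ hσ0 hσ1.le
    (by rw [Real.mul_self_sqrt hθ0.le]) (by rw [one_mul]) hσ0
  exact ⟨_, h.1, h.2⟩

/-- **NO MODULI FAMILY FADES FASTER THAN `√θ` AT THE CHIRP TOWER.**  For EVERY `Λ` with `NE9 E (Window γ) κ Λ` (`0 < θ < 1`, `γ > 0`):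
`(π∕2γ)·(√θ)^{k−i} ≤ Λ k i` for `i < k = scale X` — the section in the coupling `i` is `θ^{a}cos((π∕2γ)(√θ)^{−a}t)` (`a = k − i`),
whose derivative at the interior point `t = γ(√θ)^{a}` (where the phase is `π∕2`) has size `θ^{a}·(π∕2γ)(√θ)^{−a} = (π∕2γ)(√θ)^{a}`
(§1 `pow_mul_abs_deriv_le_moduli_of_ne9`). [folklore] -/
theorem sqrt_pow_le_moduli_chirpTower
    (hE : ∀ g U X, E g U X = Real.exp (-(κ * C.d X)) *
      ∑ i ∈ Finset.range (C.scale X), θ ^ (C.scale X - i) *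
        Real.cos (π / (2 * γ) * (Real.sqrt θ ^ (C.scale X - i))⁻¹ * g i))
    (hγ : 0 < γ) (hθ0 : 0 < θ) (hθ1 : θ < 1) {Λ : ℕ → ℕ → ℝ} (hN : NE9 E (Window γ) κ Λ)
    (U : Bg) (X : C.Dom) {i : ℕ} (hi : i < C.scale X) :
    π / (2 * γ) * Real.sqrt θ ^ (C.scale X - i) ≤ Λ (C.scale X) i := by
  have ha1 : C.scale X - i ≠ 0 := by omega
  have hσ0 : 0 < Real.sqrt θ := Real.sqrt_pos.2 hθ0
  have hσ1 : Real.sqrt θ < 1 := by rw [← Real.sqrt_one]; exact Real.sqrt_lt_sqrt hθ0.le hθ1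
  have hσa : 0 < Real.sqrt θ ^ (C.scale X - i) := pow_pos hσ0 _
  have hσa1 : Real.sqrt θ ^ (C.scale X - i) < 1 := pow_lt_one₀ hσ0.le hσ1 ha1
  -- the interior point where the phase is `π/2`
  set s : ℝ := γ * Real.sqrt θ ^ (C.scale X - i) with hs
  have hsI : s ∈ Ioo (0 : ℝ) γ := ⟨mul_pos hγ hσa, by nlinarith⟩
  set ν : ℝ := π / (2 * γ) * (Real.sqrt θ ^ (C.scale X - i))⁻¹ with hν
  have hν0 : 0 < ν := by positivity
  have hνs : ν * s = π / 2 := by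
    rw [hν, hs]; field_simp
  have hD : HasDerivAt (fun t : ℝ => Real.cos (ν * t)) (-Real.sin (ν * s) * (ν * 1)) s :=
    ((hasDerivAt_id' s).const_mul ν).cos
  have h := pow_mul_abs_deriv_le_moduli_of_ne9 (φ := fun a t => Real.cos (π / (2 * γ) * (Real.sqrt θ ^ a)⁻¹ * t))
    hE hγ hθ0.le hN U X hi hsI hD
  rw [hνs, Real.sin_pi_div_two, mul_one, neg_one_mul, abs_neg, abs_of_pos hν0] at h
  -- `θ^a · ν = (π/2γ) · (√θ)^a`
  have e : θ ^ (C.scale X - i) * ν = π / (2 * γ) * Real.sqrt θ ^ (C.scale X - i) := by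
    rw [hν, ← sqrt_pow_mul_self hθ0.le (C.scale X - i)]
    field_simp
  rwa [e] at h

/-- **COROLLARY — `√θ ≤ τ` FOR EVERY FADING FAMILY AT THE CHIRP TOWER.**  If the carriers have a domain at every scale, then any
`Λ` with `NE9 E (Window γ) κ Λ ∧ FadingMemory C₉ τ Λ` (`τ ≥ 0`) has `√θ ≤ τ`: by `sqrt_pow_le_moduli_chirpTower`,
`(π∕2γ)(√θ)^{k} ≤ C₉τ^{k}` at every scale `k ≥ 1`, impossible for `τ < √θ`.  So on ROAD 2's hypotheses ((P) + (O) at rate `θ` +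
(R₂) with constants NOT growing in the age) the fading rate `√θ` that `N22KnitDiscrete` delivers CANNOT be improved: the square root
of the real-variable Landau–Kolmogorov interpolation is intrinsic — a K3⁷ letter block fed by this road must carry `θ₅ ≤ ω²`. [folklore] -/
theorem sqrt_le_rate_of_fadingMemory_chirpTower
    (hE : ∀ g U X, E g U X = Real.exp (-(κ * C.d X)) *
      ∑ i ∈ Finset.range (C.scale X), θ ^ (C.scale X - i) *
        Real.cos (π / (2 * γ) * (Real.sqrt θ ^ (C.scale X - i))⁻¹ * g i))
    (hγ : 0 < γ) (hθ0 : 0 < θ) (hθ1 : θ < 1) (hsurj : ∀ k : ℕ, ∃ X : C.Dom, C.scale X = k) (U : Bg)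
    {Λ : ℕ → ℕ → ℝ} (hN : NE9 E (Window γ) κ Λ) {C₉ τ : ℝ} (hF : FadingMemory C₉ τ Λ) (hτ : 0 ≤ τ) :
    Real.sqrt θ ≤ τ := by
  have hσ0 : 0 < Real.sqrt θ := Real.sqrt_pos.2 hθ0
  have hπγ : 0 < π / (2 * γ) := by positivity
  -- at every scale `k ≥ 1`, in the coupling `0`
  have key : ∀ k : ℕ, 1 ≤ k → π / (2 * γ) * Real.sqrt θ ^ k ≤ C₉ * τ ^ k := by
    intro k hk
    obtain ⟨X, hX⟩ := hsurj k
    have h1 := sqrt_pow_le_moduli_chirpTower hE hγ hθ0 hθ1 hN U X (i := 0) (by omega)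
    have h2 := (hF (C.scale X) 0 (Nat.zero_le _)).2
    rw [hX, Nat.sub_zero] at h1 h2
    exact h1.trans h2
  by_contra hlt
  rw [not_le] at hlt
  rcases hτ.eq_or_lt with h0 | hτ0
  · have h := key 1 le_rfl
    rw [← h0, pow_one, zero_pow one_ne_zero, mul_zero] at h
    linarith [mul_pos hπγ hσ0]
  · have hq : 1 < Real.sqrt θ / τ := (one_lt_div hτ0).2 hlt
    obtain ⟨n, hn⟩ := pow_unbounded_of_one_lt (C₉ * (2 * γ / π)) hq
    have hk := key (n + 1) (by omega)
    have hq1 : (Real.sqrt θ / τ) ^ n ≤ (Real.sqrt θ / τ) ^ (n + 1) := pow_le_pow_right₀ hq.le (by omega)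
    have h3 : (Real.sqrt θ / τ) ^ (n + 1) ≤ C₉ * (2 * γ / π) := by
      rw [div_pow, div_le_iff₀ (pow_pos hτ0 _)]
      have h4 : Real.sqrt θ ^ (n + 1) = (2 * γ / π) * (π / (2 * γ) * Real.sqrt θ ^ (n + 1)) := by
        field_simp
      rw [h4]
      calc 2 * γ / π * (π / (2 * γ) * Real.sqrt θ ^ (n + 1)) ≤ 2 * γ / π * (C₉ * τ ^ (n + 1)) :=
            mul_le_mul_of_nonneg_left hk (by positivity)
        _ = C₉ * (2 * γ / π) * τ ^ (n + 1) := by ring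
    linarith

end Road2


end YMDAG.N22.RoadRates

end
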